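import Literature.RepresentationTheory.KonnoKonno2007.RealUnitaryRankOneKAKFibers
import Literature.RepresentationTheory.KonnoKonno2007.RealUnitaryRankOneKAKDescent
import Literature.NumberTheory.Automorphic.InfUnitaryWeakAdIdentity
import Literature.Analysis.Calculus.TaylorFlatnessDerivFamily
import Mathlib.Analysis.InnerProductSpace.Calculus
import Mathlib.Topology.Connected.TotallyDisconnected
import HarnessLib

/-!
# The torus translation law of the `KAK`-defined operator family: an ODE criterion
# (`Φ(g a_s) = Φ(g) ∘ U₀(s)` from the derivative of the matrix coefficients off `K`)

Topic `NumberTheory/Automorphic`; namespace `Literature.NumberTheory.Automorphic.IsPosDefHerm` (sequel of ★ `InfUnitaryOneParameterGroupDeriv` — the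
unitary one-parameter groups `hB.U ρ K X s` on the completion `hB.E`, (U1) `U_add`, (U2) `U_mem_unitary`, (U4) `hasDerivAt_U_emb` — and of ★
`RealUnitaryRankOneKAKFibers` — `hypV`, `kV`, `gauge`, «at most one point of `g · A` lies in `K`»).  THEOREMS ONLY; no definition, no instance, no
notation, no named fact, no `sorry`.  Cell `hodgecm-mathlib`, F0∕P3, in-house road to the letter A6 `HasUnitaryGlobalizationOfInfUnitary` at `U(2,1)`
(ROAD-GLOB v1.1, brick Φ2-core, T1a LEAD F0P3b-p01 (g3)).

THE STATEMENT (`eq_comp_U_of_hasDerivAt_inner`).  Let `G = U(α, β)` with `|β| = 1`, `H₀ = upqUnit (p₀, q₀) (−i)` the boost generator (`a_s = exp (s H₀)`, ★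
`expMem_smul_boostUnit`), `ρ` a real Lie algebra action on `V` by `B`-skew operators with line bounds at `K‖H₀‖` for `ρ H₀`, `ι = hB.emb`, `U₀(s) = hB.U ρ K H₀ s`.
Let `Φ : G → (E →L[ℂ] E)` be ANY family of contractions, strongly continuous in `g`, and `g ∈ G`.  SUPPOSE that at every `s` with `g a_s ∉ K` the matrix
coefficients satisfy the ODE **`d/dσ ⟪Φ(g a_σ) ι u, ι w⟫ |_{σ = s} = ⟪Φ(g a_s) ι (ρ H₀ u), ι w⟫`** (`u, w ∈ V`).  THEN `Φ(g a_s) = Φ(g) ∘ U₀(s)` for ALL `s`.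

THE PROOF.  On an open interval `J ∋ s₁` avoiding `K` the two families `c_u(σ) = ⟪Φ(g a_σ) ι u, ι w⟫` and `d_u(σ) = ⟪Φ(g a_{s₁}) U₀(σ − s₁) ι u, ι w⟫` are
`d/dσ`-closed with `D = ρ H₀`, agree at `s₁`, and obey the uniform-radius factorial bounds `C_u n! (K‖H₀‖)ⁿ ‖ι w‖` (line bounds, `‖Φ‖, ‖U₀‖ ≤ 1`), so the Taylor
engine ★ `eqOn_of_hasDerivAt_family_of_factorial_bound` gives `c_u = d_u` on `J`; density of `ι V` (★ `eq_of_forall_emb`) turns this into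
`Φ(g a_σ) = Φ(g a_{s₁}) U₀(σ − s₁)`, i.e. `W(σ) := Φ(g a_σ) U₀(−σ)` is locally constant off the set `{s | g a_s ∈ K}`, which has AT MOST ONE point (★
`subsingleton_setOf_mul_hypV_mem_range_kV`); `W` being strongly continuous, it is constant on `ℝ` (constant on the two half-lines, glued at the bad point by
continuity), and `W(0) = Φ(g)`.  [HarishChandra1953, §9]; [Knapp2002, Thm. 7.39].

## Mathlib ∕ tree search
Tree: ★ `hB.U`, `U_add`, `U_zero`, `U_mem_unitary`, `norm_U`, `hasDerivAt_U_emb`, `continuous_U_apply` (A-p14 (g24)); ★ `U_neg_comp_U` (P3 `InfUnitaryWeakAdIdentity`); ★ `continuous_apply_of_strongly_continuous` (Φ1 `RealUnitaryRankOneKAKDescent`); ★ `eq_of_forall_emb`, `denseRange_emb` (G0);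
★ A′ `eqOn_of_hasDerivAt_family_of_factorial_bound`; ★ S1a `gauge_kV`, `exists_kV_eq_of_gauge_eq_one`, `subsingleton_setOf_mul_hypV_mem_range_kV`,
`continuous_gauge`, `continuous_hypV`.  Mathlib: `IsPreconnected.constant`, `DenseRange.induction_on`, `tendsto_nhds_unique`, `Metric.isOpen_iff`.
Dedup: `rg "eq_comp_U_of_hasDerivAt|TorusLaw" Literature/` — no hits.

## References
* Harish-Chandra, *Representations of a semisimple Lie group on a Banach space. I*, Trans. AMS 75 (1953), §9 [HarishChandra1953].
* A. W. Knapp, *Lie Groups Beyond an Introduction*, 2nd ed. (2002), Thm. 7.39 [Knapp2002].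
-/

set_option autoImplicit false

noncomputable section

attribute [local instance 100] LieRing.ofAssociativeRing

open Finset Set Filter Complex
open scoped Nat InnerProductSpace ComplexConjugate Matrix.Norms.Operator Topology MatrixGroups

namespace Literature.NumberTheory.Automorphic

namespace IsPosDefHerm

open Literature.RepresentationTheory.KonnoKonno2007 Literature.RepresentationTheory.KonnoKonno2007.RealDualPair
open Literature.RepresentationTheory.KonnoKonno2007.RealDualPair.UForm Literature.RepresentationTheory.BorelWallach2000

universe u

variable {α β : Type*} [Fintype α] [DecidableEq α] [Fintype β] [DecidableEq β] (p₀ : α) (q₀ : β)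
  {V : Type u} [AddCommGroup V] [Module ℂ V] {B : V →ₗ⋆[ℂ] V →ₗ[ℂ] ℂ} (hB : IsPosDefHerm B)
include hB

variable {ρ : (uFormGroup α β).lie →ₗ⁅ℝ⁆ Module.End ℂ V}

/-! ## §1 Density lemmas on the completion -/

omit [Fintype α] [DecidableEq α] [Fintype β] [DecidableEq β] in
/-- Two vectors of `E` with the same inner products against `ι V` are equal (density of `ι V`). [cite: BorelWallach2000, 0 §2.5] -/
theorem eq_of_forall_inner_emb {x y : hB.E} (h : ∀ w : V, ⟪x, hB.emb w⟫_ℂ = ⟪y, hB.emb w⟫_ℂ) : x = y := by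
  have hfun : (fun z : hB.E => ⟪x, z⟫_ℂ) = fun z => ⟪y, z⟫_ℂ :=
    hB.denseRange_emb.equalizer (continuous_const.inner continuous_id) (continuous_const.inner continuous_id) (funext fun w => h w)
  have h' : ⟪x - y, x - y⟫_ℂ = 0 := by
    rw [inner_sub_left, congrFun hfun (x - y), sub_self]
  exact sub_eq_zero.1 (inner_self_eq_zero.1 h')

omit [Fintype α] [DecidableEq α] [Fintype β] [DecidableEq β] in
/-- Two bounded operators with the same matrix coefficients on `ι V × ι V` are equal. [cite: BorelWallach2000, 0 §2.5] -/
theorem eq_of_forall_inner_emb_emb {S T : hB.E →L[ℂ] hB.E} (h : ∀ u w : V, ⟪S (hB.emb u), hB.emb w⟫_ℂ = ⟪T (hB.emb u), hB.emb w⟫_ℂ) : S = T :=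
  hB.eq_of_forall_emb fun u => hB.eq_of_forall_inner_emb fun w => h u w

/-! ## §2 The set of parameters where `g a_s ∈ K` is closed with open complement -/

omit [AddCommGroup V] [Module ℂ V] hB in
/-- `h ∈ K ⇔ gauge h = 1` (★ `gauge_kV`, ★ `exists_kV_eq_of_gauge_eq_one`). [cite: Knapp2002, Thm. 7.39] -/
theorem mem_range_kV_iff_gauge_eq_one [Subsingleton β] (h : UForm α β) : h ∈ Set.range (kV α β) ↔ gauge q₀ h = 1 := by
  constructor
  · rintro ⟨k, rfl⟩; exact gauge_kV q₀ k
  · intro hg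
    obtain ⟨k, hk⟩ := exists_kV_eq_of_gauge_eq_one q₀ h hg
    exact ⟨k, hk.symm⟩

omit [AddCommGroup V] [Module ℂ V] hB in
/-- The «good» parameter set `{s | g a_s ∉ K}` is open. [cite: Knapp2002, Thm. 7.39] -/
theorem isOpen_setOf_mul_hypV_not_mem [Subsingleton β] (g : UForm α β) :
    IsOpen {s : ℝ | g * hypV p₀ q₀ s ∉ Set.range (kV α β)} := by
  have hc : Continuous fun s : ℝ => gauge q₀ (g * hypV p₀ q₀ s) :=
    (continuous_gauge q₀).comp (continuous_const.mul (continuous_hypV p₀ q₀))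
  have heq : {s : ℝ | g * hypV p₀ q₀ s ∉ Set.range (kV α β)} = (fun s : ℝ => gauge q₀ (g * hypV p₀ q₀ s)) ⁻¹' {1}ᶜ := by
    ext s
    simp only [Set.mem_setOf_eq, mem_range_kV_iff_gauge_eq_one q₀, Set.mem_preimage, Set.mem_compl_iff, Set.mem_singleton_iff]
  rw [heq]
  exact isOpen_compl_singleton.preimage hc

/-! ## §3 The local step: on an interval avoiding `K`, `Φ(g a_σ) = Φ(g a_{s₁}) ∘ U₀(σ − s₁)` -/

/-- **Local torus law** from the matrix-coefficient ODE on an open interval `J ∋ s₁` where it holds. [cite: HarishChandra1953, §9] -/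
theorem eq_comp_U_on_interval {K : ℝ} (hK : 0 < K)
    (hX : ∀ x y, B (ρ (upqUnit (p₀, q₀) (-I)) x) y = -B x (ρ (upqUnit (p₀, q₀) (-I)) y))
    (hb : ∀ v : V, ∃ C : ℝ, ∀ n, ‖hB.emb (((ρ (upqUnit (p₀, q₀) (-I)) : V →ₗ[ℂ] V) ^ n) v)‖ ≤
      C * n ! * (K * ‖((upqUnit (p₀, q₀) (-I) : (uFormGroup α β).lie) : Matrix (α ⊕ β) (α ⊕ β) ℂ)‖) ^ n)
    (Φ : UForm α β → (hB.E →L[ℂ] hB.E)) (hΦb : ∀ g, ‖Φ g‖ ≤ 1) (g : UForm α β) {a b s₁ : ℝ} (hs₁ : s₁ ∈ Ioo a b)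
    (hder : ∀ s ∈ Ioo a b, ∀ u w : V,
      HasDerivAt (fun σ : ℝ => ⟪Φ (g * hypV p₀ q₀ σ) (hB.emb u), hB.emb w⟫_ℂ)
        (⟪Φ (g * hypV p₀ q₀ s) (hB.emb (ρ (upqUnit (p₀, q₀) (-I)) u)), hB.emb w⟫_ℂ) s)
    {σ : ℝ} (hσ : σ ∈ Ioo a b) :
    Φ (g * hypV p₀ q₀ σ) = Φ (g * hypV p₀ q₀ s₁) ∘L hB.U ρ K (upqUnit (p₀, q₀) (-I)) (σ - s₁) := by
  set H₀ : (uFormGroup α β).lie := upqUnit (p₀, q₀) (-I) with hH₀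
  set L : ℝ := K * ‖(H₀ : Matrix (α ⊕ β) (α ⊕ β) ℂ)‖ with hL
  have hL0 : 0 ≤ L := by positivity
  refine hB.eq_of_forall_inner_emb_emb fun u w => ?_
  -- the two `d/dσ`-closed families (index `u`, fixed `w`)
  set c : V → ℝ → ℂ := fun u σ => ⟪Φ (g * hypV p₀ q₀ σ) (hB.emb u), hB.emb w⟫_ℂ with hc
  set d : V → ℝ → ℂ := fun u σ => ⟪(Φ (g * hypV p₀ q₀ s₁) ∘L hB.U ρ K H₀ (σ - s₁)) (hB.emb u), hB.emb w⟫_ℂ with hd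
  change c u σ = d u σ
  have hcder : ∀ u, ∀ s ∈ Ioo a b, HasDerivAt (c u) (c (ρ H₀ u) s) s := fun u s hs => hder s hs u w
  have hdder : ∀ u, ∀ s ∈ Ioo a b, HasDerivAt (d u) (d (ρ H₀ u) s) s := by
    intro u s _
    have h1 : HasDerivAt (fun σ : ℝ => hB.U ρ K H₀ (σ - s₁) (hB.emb u)) (hB.U ρ K H₀ (s - s₁) (hB.emb (ρ H₀ u))) s := by
      have h := (hB.hasDerivAt_U_emb hK hX hb u (s - s₁)).scomp s ((hasDerivAt_id s).sub_const s₁)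
      simpa [Function.comp_def] using h
    have h2 : HasDerivAt (fun σ : ℝ => Φ (g * hypV p₀ q₀ s₁) (hB.U ρ K H₀ (σ - s₁) (hB.emb u)))
        (Φ (g * hypV p₀ q₀ s₁) (hB.U ρ K H₀ (s - s₁) (hB.emb (ρ H₀ u)))) s :=
      ((Φ (g * hypV p₀ q₀ s₁)).restrictScalars ℝ).hasFDerivAt.comp_hasDerivAt s h1
    have h3 := h2.inner ℂ (hasDerivAt_const s (hB.emb w))
    simpa [hd, ContinuousLinearMap.comp_apply] using h3
  -- factorial bounds (line bounds for `ρ H₀`, contractions `Φ`, `U₀`)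
  have hbd : ∀ (F : V → ℝ → ℂ), (∀ u s, ‖F u s‖ ≤ ‖hB.emb u‖ * ‖hB.emb w‖) →
      ∀ u, ∃ M, ∀ n, ∀ s ∈ Ioo a b, ‖F ((fun x => ρ H₀ x)^[n] u) s‖ ≤ M * n ! / (L + 1)⁻¹ ^ n := by
    intro F hF u
    obtain ⟨C, hC⟩ := hb u
    refine ⟨C * ‖hB.emb w‖, fun n s _ => ?_⟩
    have hC0 : 0 ≤ C := by
      have h := hC 0
      simp only [pow_zero, Nat.factorial_zero, Nat.cast_one, mul_one, Module.End.one_apply] at h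
      exact (norm_nonneg _).trans h
    have hiter : (fun x => ρ H₀ x)^[n] u = ((ρ H₀ : V →ₗ[ℂ] V) ^ n) u := by rw [Module.End.pow_apply]
    rw [hiter]
    calc ‖F (((ρ H₀ : V →ₗ[ℂ] V) ^ n) u) s‖ ≤ ‖hB.emb (((ρ H₀ : V →ₗ[ℂ] V) ^ n) u)‖ * ‖hB.emb w‖ := hF _ _
      _ ≤ C * n ! * L ^ n * ‖hB.emb w‖ := by gcongr; exact hC n
      _ ≤ C * n ! * (L + 1) ^ n * ‖hB.emb w‖ := by gcongr; linarith
      _ = C * ‖hB.emb w‖ * n ! / (L + 1)⁻¹ ^ n := by rw [inv_pow, div_eq_mul_inv, inv_inv]; ring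
  have hcbd := hbd c (fun u s => by
    calc ‖c u s‖ ≤ ‖Φ (g * hypV p₀ q₀ s) (hB.emb u)‖ * ‖hB.emb w‖ := norm_inner_le_norm _ _
      _ ≤ ‖hB.emb u‖ * ‖hB.emb w‖ := by
          gcongr; exact ((Φ _).le_of_opNorm_le (hΦb _) _).trans_eq (one_mul _))
  have hdbd := hbd d (fun u s => by
    calc ‖d u s‖ ≤ ‖(Φ (g * hypV p₀ q₀ s₁) ∘L hB.U ρ K H₀ (s - s₁)) (hB.emb u)‖ * ‖hB.emb w‖ := norm_inner_le_norm _ _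
      _ ≤ ‖hB.emb u‖ * ‖hB.emb w‖ := by
          gcongr
          rw [ContinuousLinearMap.comp_apply]
          exact ((Φ _).le_of_opNorm_le (hΦb _) _).trans (by rw [one_mul, hB.norm_U hK.le hX hb]))
  -- equality at `s₁`
  have h0 : ∀ u, c u s₁ = d u s₁ := fun u => by
    simp only [hc, hd, sub_self, hB.U_zero hK.le hX hb, ContinuousLinearMap.comp_apply, ContinuousLinearMap.one_def,
      ContinuousLinearMap.coe_id', id_eq]
  exact Literature.Analysis.Calculus.eqOn_of_hasDerivAt_family_of_factorial_bound isOpen_Ioo isPreconnected_Ioo hs₁ c d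
    (fun x => ρ H₀ x) hcder hdder (by positivity) hcbd hdbd h0 u hσ


/-! ## §4 Patching: local constancy off the (at most one) bad point + strong continuity ⇒ the torus law for all `s` -/

/-- **THE TORUS TRANSLATION LAW FROM THE MATRIX-COEFFICIENT ODE** (`|β| = 1`).  If `Φ` is a strongly continuous family of contractions on the completion
and, at every `s` with `g a_s ∉ K`, `d/dσ ⟪Φ(g a_σ) ι u, ι w⟫|_{σ=s} = ⟪Φ(g a_s) ι(ρ H₀ u), ι w⟫` for all `u, w ∈ V`, then `Φ(g a_s) = Φ(g) ∘ U₀(s)` for every `s`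
(`U₀ = hB.U ρ K H₀`): locally on the good set by `eq_comp_U_on_interval`, then across the at most one bad point (★ `subsingleton_setOf_mul_hypV_mem_range_kV`) by
strong continuity. [cite: HarishChandra1953, §9] [cite: Knapp2002, Thm. 7.39] -/
theorem eq_comp_U_of_hasDerivAt_inner [Subsingleton β] {K : ℝ} (hK : 0 < K)
    (hX : ∀ x y, B (ρ (upqUnit (p₀, q₀) (-I)) x) y = -B x (ρ (upqUnit (p₀, q₀) (-I)) y))
    (hb : ∀ v : V, ∃ C : ℝ, ∀ n, ‖hB.emb (((ρ (upqUnit (p₀, q₀) (-I)) : V →ₗ[ℂ] V) ^ n) v)‖ ≤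
      C * n ! * (K * ‖((upqUnit (p₀, q₀) (-I) : (uFormGroup α β).lie) : Matrix (α ⊕ β) (α ⊕ β) ℂ)‖) ^ n)
    (Φ : UForm α β → (hB.E →L[ℂ] hB.E)) (hΦb : ∀ g, ‖Φ g‖ ≤ 1) (hΦc : ∀ x, Continuous fun g => Φ g x) (g : UForm α β)
    (hder : ∀ s : ℝ, g * hypV p₀ q₀ s ∉ Set.range (kV α β) → ∀ u w : V,
      HasDerivAt (fun σ : ℝ => ⟪Φ (g * hypV p₀ q₀ σ) (hB.emb u), hB.emb w⟫_ℂ)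
        (⟪Φ (g * hypV p₀ q₀ s) (hB.emb (ρ (upqUnit (p₀, q₀) (-I)) u)), hB.emb w⟫_ℂ) s)
    (s : ℝ) : Φ (g * hypV p₀ q₀ s) = Φ g ∘L hB.U ρ K (upqUnit (p₀, q₀) (-I)) s := by
  set H₀ : (uFormGroup α β).lie := upqUnit (p₀, q₀) (-I) with hH₀
  -- the conjugated family `W σ = Φ(g a_σ) ∘ U₀(−σ)`
  set W : ℝ → (hB.E →L[ℂ] hB.E) := fun σ => Φ (g * hypV p₀ q₀ σ) ∘L hB.U ρ K H₀ (-σ) with hW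
  set O : Set ℝ := {σ : ℝ | g * hypV p₀ q₀ σ ∉ Set.range (kV α β)} with hO
  have hOopen : IsOpen O := isOpen_setOf_mul_hypV_not_mem p₀ q₀ g
  -- (a) `W` is locally constant on `O`
  have hloc : ∀ s₁ ∈ O, ∀ᶠ σ in 𝓝 s₁, W σ = W s₁ := by
    intro s₁ hs₁
    obtain ⟨ε, hε, hball⟩ := Metric.isOpen_iff.1 hOopen s₁ hs₁
    have hI : Ioo (s₁ - ε) (s₁ + ε) ⊆ O := by
      intro σ hσ; apply hball; rw [Metric.mem_ball, Real.dist_eq, abs_lt]; constructor <;> linarith [hσ.1, hσ.2]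
    have hmem : s₁ ∈ Ioo (s₁ - ε) (s₁ + ε) := ⟨by linarith, by linarith⟩
    filter_upwards [Ioo_mem_nhds (show s₁ - ε < s₁ by linarith) (show s₁ < s₁ + ε by linarith)] with σ hσ
    have hloc' := hB.eq_comp_U_on_interval p₀ q₀ hK hX hb Φ hΦb g hmem (fun s hs u w => hder s (hI hs) u w) hσ
    simp only [hW]
    rw [hloc', ContinuousLinearMap.comp_assoc, ← hB.U_add hK.le hX hb]
    congr 2
    ring
  -- (b) `σ ↦ W σ x` is continuous
  have hWc : ∀ x : hB.E, Continuous fun σ => W σ x := by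
    intro x
    have hU : Continuous fun σ : ℝ => hB.U ρ K H₀ (-σ) x := (hB.continuous_U_apply hK hX hb x).comp continuous_neg
    have h := continuous_apply_of_strongly_continuous (E := hB.E) (fun σ : ℝ => Φ (g * hypV p₀ q₀ σ))
      (fun v => (hΦc v).comp (continuous_const.mul (continuous_hypV p₀ q₀))) (fun σ => hΦb _) hU
    simpa [hW, ContinuousLinearMap.comp_apply] using h
  -- (c) on an open preconnected `J ⊆ O`, `W` is constant
  have hconstJ : ∀ J : Set ℝ, IsPreconnected J → J ⊆ O → ∀ x₀ ∈ J, ∀ σ ∈ J, W σ = W x₀ := by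
    intro J hJ hJO x₀ hx₀ σ hσ
    classical
    -- the Boolean indicator of `{W = W x₀}` is continuous on `J`
    let f : ℝ → Bool := fun σ => decide (W σ = W x₀)
    have hf : ContinuousOn f J := by
      intro σ₀ hσ₀
      refine ContinuousAt.continuousWithinAt ?_
      by_cases h : W σ₀ = W x₀
      · -- near `σ₀`, `W = W σ₀ = W x₀`
        have hev : ∀ᶠ σ in 𝓝 σ₀, f σ = f σ₀ := by
          filter_upwards [hloc σ₀ (hJO hσ₀)] with σ hσ
          simp only [f, hσ, h]
        exact continuousAt_const.congr (f := fun _ => f σ₀) (hev.mono fun σ hσ => hσ.symm)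
      · -- near `σ₀`, `W ≠ W x₀` (strong continuity)
        obtain ⟨x, hx⟩ : ∃ x, W σ₀ x ≠ W x₀ x := by
          by_contra hcon
          push Not at hcon
          exact h (ContinuousLinearMap.ext hcon)
        have hev : ∀ᶠ σ in 𝓝 σ₀, W σ x ≠ W x₀ x :=
          (hWc x).continuousAt.eventually_ne hx
        have hev' : ∀ᶠ σ in 𝓝 σ₀, f σ = f σ₀ := by
          filter_upwards [hev] with σ hσ
          have : W σ ≠ W x₀ := fun heq => hσ (by rw [heq])
          simp only [f, this, h, decide_false]
        exact continuousAt_const.congr (f := fun _ => f σ₀) (hev'.mono fun σ hσ => hσ.symm)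
    have h := hJ.constant hf hσ hx₀
    have h' : f σ = true := h.trans (by simp [f])
    simpa [f] using h'
  -- (d) `W` is constant on `ℝ`
  have hconst : ∀ σ, W σ = W 0 := by
    have hbad := subsingleton_setOf_mul_hypV_mem_range_kV p₀ q₀ g
    by_cases hO : O = Set.univ
    · intro σ
      exact hconstJ Set.univ isPreconnected_univ (by rw [hO]) 0 (Set.mem_univ _) σ (Set.mem_univ _)
    · -- exactly one bad point `p`
      obtain ⟨p, hp⟩ : ∃ p, p ∉ O := by
        by_contra hcon; push Not at hcon; exact hO (Set.eq_univ_of_forall hcon)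
      have hpK : g * hypV p₀ q₀ p ∈ Set.range (kV α β) := by
        by_contra h'; exact hp h'
      have hOeq : ∀ σ, σ ≠ p → σ ∈ O := by
        intro σ hσp hmem
        exact hσp (hbad hmem hpK)
      -- constancy on the two half-lines
      have hleft : ∀ σ < p, W σ = W (p - 1) := fun σ hσ =>
        hconstJ (Iio p) isPreconnected_Iio (fun x hx => hOeq x (ne_of_lt hx)) (p - 1) (by simp) σ hσ
      have hright : ∀ σ > p, W σ = W (p + 1) := fun σ hσ =>
        hconstJ (Ioi p) isPreconnected_Ioi (fun x hx => hOeq x (ne_of_gt hx)) (p + 1) (by simp) σ hσ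
      -- continuity at `p` glues: `W p = W (p−1) = W (p+1)`
      have hWp_left : W p = W (p - 1) := by
        refine ContinuousLinearMap.ext fun x => ?_
        have ht : Tendsto (fun σ => W σ x) (𝓝[<] p) (𝓝 (W p x)) := ((hWc x).tendsto p).mono_left nhdsWithin_le_nhds
        have hev : (fun σ => W σ x) =ᶠ[𝓝[<] p] fun _ => W (p - 1) x :=
          eventually_nhdsWithin_of_forall fun σ hσ => by simp only [hleft σ hσ]
        exact tendsto_nhds_unique (ht.congr' hev) tendsto_const_nhds
      have hWp_right : W p = W (p + 1) := by
        refine ContinuousLinearMap.ext fun x => ?_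
        have ht : Tendsto (fun σ => W σ x) (𝓝[>] p) (𝓝 (W p x)) := ((hWc x).tendsto p).mono_left nhdsWithin_le_nhds
        have hev : (fun σ => W σ x) =ᶠ[𝓝[>] p] fun _ => W (p + 1) x :=
          eventually_nhdsWithin_of_forall fun σ hσ => by simp only [hright σ hσ]
        exact tendsto_nhds_unique (ht.congr' hev) tendsto_const_nhds
      have hall : ∀ σ, W σ = W p := by
        intro σ
        rcases lt_trichotomy σ p with hlt | heq | hgt
        · rw [hleft σ hlt, hWp_left]
        · rw [heq]
        · rw [hright σ hgt, hWp_right]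
      intro σ
      rw [hall σ, hall 0]
  -- (e) conclusion
  have hW0 : W 0 = Φ g := by
    simp only [hW, neg_zero, hypV_zero, mul_one, hB.U_zero hK.le hX hb, ContinuousLinearMap.one_def, ContinuousLinearMap.comp_id]
  have h := hconst s
  rw [hW0] at h
  -- `Φ(g a_s) = W s ∘ U₀ s`
  calc Φ (g * hypV p₀ q₀ s) = (Φ (g * hypV p₀ q₀ s) ∘L hB.U ρ K H₀ (-s)) ∘L hB.U ρ K H₀ s := by
        rw [ContinuousLinearMap.comp_assoc, hB.U_neg_comp_U hK.le hX hb s, ContinuousLinearMap.one_def, ContinuousLinearMap.comp_id]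
    _ = Φ g ∘L hB.U ρ K H₀ s := by
        have : Φ (g * hypV p₀ q₀ s) ∘L hB.U ρ K H₀ (-s) = W s := rfl
        rw [this, h]

end IsPosDefHerm

end Literature.NumberTheory.Automorphic

end
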